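import Summits.KontsevichZagierPeriods.KontsevichZagierPeriods.Theorems.SoloInformedAlgVertexInduction
import HarnessLib

/-!
# The DEN-calculus over `K`: the local packages at boundary zeros

Solo programme `solo-KontsevichZagierPeriods-informed`, session s107, step (x-s) of the general
two-dimensional algorithm.  With THEOREM VG (`soloInformed_vertexGermOK`) every germ
`u xᵉ · W · F`, `W` a unit on the closed square and `F` with an isolated zero at a vertex, is a
presentable denominator (`soloInformed_presentableDenK_of_vertexGerm`, after a vertex reflection).
This file derives the two LOCAL PACKAGES of the algorithm for `Q = u xᵉ · R`:

* **VERTEX** `soloInformed_locallyPresentableDenK_vertex` — `Q` is locally presentable at the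
  vertex `0` when `0` is an isolated zero of `R` in the closed square (corner germs + VERTEX-LOCAL);
* **EDGE** `soloInformed_locallyPresentableDenK_edge` — `Q` is locally presentable at an edge
  point `(0, t)`, `0 < t`, `t ∈ K`, which is an isolated zero of `R` in the closed square: a small
  cell through `(0, t)` is split horizontally at the (algebraic) height of the zero
  (RULE SPLIT over `K`), and each half is a vertex germ.

References: M. Kontsevich, D. Zagier, *Periods* (2001), §1.2; J. Kollár, *Lectures on Resolution
of Singularities* (2007), §1.8.
-/

noncomputable section

open scoped BigOperators

namespace Summit.KontsevichZagierPeriods.KontsevichZagierPeriods.Theorems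

variable {K : Type*} [Field K] [Algebra K ℝ]

/-! ### Small geometric facts -/

/-- Grid cell points of closed-cube points lie in the closed cube. [this work] -/
theorem soloInformed_cellPoint_mem_cube {n N : ℕ} {c : Fin n → ℕ} (hc : ∀ j, c j < N)
    {y : Fin n → ℝ} (hy : y ∈ soloInformedCube n) :
    (fun j => ((c j : ℝ) + y j) / N) ∈ soloInformedCube n := fun j => by
  have hN : (0 : ℝ) < N := by exact_mod_cast lt_of_le_of_lt (Nat.zero_le _) (hc j)
  have hc1 : (c j : ℝ) + 1 ≤ N := by exact_mod_cast hc j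
  refine ⟨div_nonneg (add_nonneg (Nat.cast_nonneg _) (hy j).1) hN.le, ?_⟩
  rw [div_le_one hN]
  linarith [(hy j).2]

/-- Scale moves with `0 ≤ α`, `0 ≤ β`, `α + β ≤ 1` preserve the closed cube. [this work] -/
theorem soloInformed_scaleMoveR_mem_cube {n : ℕ} (i : Fin n) {α β : ℝ} (hα : 0 ≤ α) (hβ : 0 ≤ β)
    (hαβ : α + β ≤ 1) {y : Fin n → ℝ} (hy : y ∈ soloInformedCube n) :
    soloInformedScaleMoveR i α β y ∈ soloInformedCube n := fun j => by
  by_cases hj : j = i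
  · subst hj
    rw [soloInformed_scaleMoveR_apply_self]
    have h1 := (hy j).1
    have h2 := (hy j).2
    exact ⟨add_nonneg hα (mul_nonneg hβ h1), by nlinarith⟩
  · rw [soloInformed_scaleMoveR_apply_ne i α β y hj]
    exact hy j

/-- The empty vertex move fixes the origin. [this work] -/
theorem soloInformed_vertexMove_empty_zero :
    soloInformedVertexMove (∅ : Finset (Fin 2)) (0 : Fin 2 → ℝ) = ![0, 0] := by
  funext j
  fin_cases j <;> simp [soloInformedVertexMove]

/-! ### Vertex germs after a reflection -/

/-- **Vertex germs are presentable.**  Over a real-root-closed field `K` of real algebraic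
numbers: if `T` has no zero on the open square and takes there the values of `u xᵉ · W · F` with
`u ≠ 0`, `xᵉ` not involving the reflected directions `S`, `W` a unit on the closed square and `F`
without zero on the closed square except at the vertex `Φ_S(0)`, then `T` is a presentable
denominator (THEOREM VG after the vertex reflection `Φ_S`). [this work] -/
theorem soloInformed_presentableDenK_of_vertexGerm
    (hK : ∀ c : K, IsAlgebraic ℚ (algebraMap K ℝ c)) (hKrc : SoloInformedRealRootClosed K)
    (S : Finset (Fin 2)) {e : Fin 2 →₀ ℕ} (he : ∀ j ∈ S, e j = 0) {u : K} (hu : u ≠ 0)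
    {W F T : MvPolynomial (Fin 2) K}
    (hW : ∀ y ∈ soloInformedCube 2, (MvPolynomial.aeval y W : ℝ) ≠ 0)
    (hF : ∀ y ∈ soloInformedCube 2, y ≠ soloInformedVertexMove S 0 →
      (MvPolynomial.aeval y F : ℝ) ≠ 0)
    (hT0 : ∀ x ∈ soloInformedOpenCube 2, (MvPolynomial.aeval x T : ℝ) ≠ 0)
    (hT : ∀ x ∈ soloInformedOpenCube 2, (MvPolynomial.aeval x T : ℝ) =
      MvPolynomial.aeval x (MvPolynomial.monomial e u * (W * F))) :
    SoloInformedPresentableDenK T := by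
  set B := MvPolynomial.monomial e u *
    (soloInformedVertexReflectK S W * soloInformedVertexReflectK S F) with hB
  -- THEOREM VG for the reflected germ
  have hW' : ∀ y ∈ soloInformedCube 2,
      (MvPolynomial.aeval y (soloInformedVertexReflectK S W) : ℝ) ≠ 0 := fun y hy => by
    rw [soloInformed_aeval_vertexReflectK]
    exact hW _ (soloInformed_vertexMove_mem_closedCube S hy)
  have hF' : ∀ y ∈ soloInformedCube 2, y ≠ 0 →
      (MvPolynomial.aeval y (soloInformedVertexReflectK S F) : ℝ) ≠ 0 := fun y hy hy0 => by
    rw [soloInformed_aeval_vertexReflectK]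
    exact hF _ (soloInformed_vertexMove_mem_closedCube S hy)
      fun h => hy0 (soloInformed_vertexMove_injective S h)
  have hPB : SoloInformedPresentableDenK B := soloInformed_vertexGermOK hK hKrc _ e u _ hu hW' hF'
  -- the monomial is `Φ_S`-invariant
  have hmono : ∀ x : Fin 2 → ℝ,
      (∏ j, soloInformedVertexMove S x j ^ e j) = ∏ j, x j ^ e j := fun x =>
    Finset.prod_congr rfl fun j _ => by
      by_cases hj : j ∈ S
      · rw [he j hj, pow_zero, pow_zero]
      · simp [soloInformedVertexMove, hj]
  have hval : ∀ x : Fin 2 → ℝ, (MvPolynomial.aeval (soloInformedVertexMove S x) B : ℝ) =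
      MvPolynomial.aeval x (MvPolynomial.monomial e u * (W * F)) := fun x => by
    rw [hB, map_mul, map_mul, soloInformed_aevalK_monomial, soloInformed_aeval_vertexReflectK,
      soloInformed_aeval_vertexReflectK, soloInformed_vertexMove_vertexMove, hmono, map_mul,
      map_mul, soloInformed_aevalK_monomial]
  refine soloInformed_presentableDenK_of_eq_vertexMove hK S hPB (fun x hx => ?_) fun x hx => ?_
  · rw [← soloInformed_vertexMove_vertexMove S x, hval,
      ← hT _ (soloInformed_vertexMove_mem S hx)]
    exact hT0 _ (soloInformed_vertexMove_mem S hx)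
  · rw [hval, hT x hx]

/-! ### The VERTEX package -/

/-- **VERTEX package.**  Over a real-root-closed field `K` of real algebraic numbers:
`u xᵉ · R` (`u ≠ 0`, no zero on the open square) is locally presentable at the vertex `0` as soon
as `R` has no zero `y ≠ 0` in the closed square within distance `r` of `0`. [this work] -/
theorem soloInformed_locallyPresentableDenK_vertex
    (hK : ∀ c : K, IsAlgebraic ℚ (algebraMap K ℝ c)) (hKrc : SoloInformedRealRootClosed K)
    (e : Fin 2 →₀ ℕ) {u : K} (hu : u ≠ 0) {R : MvPolynomial (Fin 2) K}
    (hP0 : ∀ x ∈ soloInformedOpenCube 2,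
      (MvPolynomial.aeval x (MvPolynomial.monomial e u * R) : ℝ) ≠ 0)
    {r : ℝ} (hr : 0 < r)
    (hiso : ∀ y ∈ soloInformedCube 2, dist y 0 < r → y ≠ 0 → (MvPolynomial.aeval y R : ℝ) ≠ 0) :
    SoloInformedLocallyPresentableDenK (MvPolynomial.monomial e u * R) 0 := by
  refine soloInformed_locallyPresentableDenK_zero_of_germs hK e hu hr
    (fun y hy hlt hy0 => hiso y hy ?_ hy0) ⌈r⁻¹⌉₊ fun N hN => ?_
  · rw [dist_pi_lt_iff hr]
    intro j
    rw [Real.dist_eq, Pi.zero_apply, sub_zero, abs_of_nonneg (hy j).1]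
    exact hlt j
  have hN0 : 0 < N := lt_of_le_of_lt (Nat.zero_le _) hN
  have hNr : (0 : ℝ) < N := by exact_mod_cast hN0
  have hNinv : (N : ℝ)⁻¹ < r := by
    rw [inv_lt_comm₀ hNr hr]
    exact lt_of_le_of_lt (Nat.le_ceil _) (by exact_mod_cast hN)
  have hNK : (N : K) ≠ 0 := soloInformed_natCast_ne_zeroK hN0
  refine soloInformed_presentableDenK_of_vertexGerm hK hKrc ∅ (e := e)
    (fun j hj => absurd hj (Finset.notMem_empty j))
    (u := u * ∏ j, ((N : K)⁻¹) ^ e j)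
    (mul_ne_zero hu (Finset.prod_ne_zero_iff.2 fun j _ => pow_ne_zero _ (inv_ne_zero hNK)))
    (W := 1) (F := soloInformedGridSubstK Finset.univ N (fun _ => 0) R)
    (fun y _ => by rw [map_one]; exact one_ne_zero) (fun y hy hy0 => ?_) (fun x hx => ?_)
    fun x _ => ?_
  · -- the rescaled germ has an isolated zero at `0`
    rw [soloInformed_vertexMove_empty_zero] at hy0
    have hy0' : y ≠ 0 := fun h => hy0 (by rw [h]; funext j; fin_cases j <;> simp)
    rw [soloInformed_aeval_gridSubstK]
    refine hiso _ (soloInformed_gridMoveR_zero_mem_cube hN0 hy) ?_ ?_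
    · rw [soloInformed_gridMoveR_univ, dist_pi_lt_iff hr]
      intro j
      rw [Real.dist_eq, Pi.zero_apply, sub_zero, Nat.cast_zero, zero_add,
        abs_of_nonneg (div_nonneg (hy j).1 hNr.le)]
      calc y j / N ≤ 1 / N := div_le_div_of_nonneg_right (hy j).2 hNr.le
        _ = (N : ℝ)⁻¹ := one_div _
        _ < r := hNinv
    · rw [soloInformed_gridMoveR_univ]
      intro h
      apply hy0'
      funext j
      have hj := congr_fun h j
      rw [Pi.zero_apply, Nat.cast_zero, zero_add, div_eq_zero_iff] at hj
      rw [Pi.zero_apply]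
      exact hj.resolve_right hNr.ne'
  · rw [soloInformed_aeval_gridSubstK]
    exact hP0 _ (soloInformed_gridMoveR_mem_openCube _ (fun _ => hN0) hx)
  · rw [soloInformed_aeval_gridSubstK, soloInformed_gridMoveR_univ]
    simp only [map_mul, one_mul, soloInformed_aevalK_monomial, soloInformed_aeval_gridSubstK,
      soloInformed_gridMoveR_univ, map_prod, map_pow, map_inv₀, map_natCast, Nat.cast_zero, zero_add]
    have hprod : (∏ j, (x j / (N : ℝ)) ^ e j) = (∏ j, ((N : ℝ)⁻¹) ^ e j) * ∏ j, x j ^ e j := by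
      rw [← Finset.prod_mul_distrib]
      exact Finset.prod_congr rfl fun j _ => by rw [div_eq_mul_inv, mul_pow, mul_comm]
    rw [hprod]
    ring

/-! ### The EDGE package -/

/-- **A cell through an edge zero.**  Over a real-root-closed field `K` of real algebraic numbers:
the cell polynomial of `u xᵉ · R` on a cell `(c + [0,1]²)/N` with `c₀ = 0`, `c₁ ≥ 1`, on whose
closure `R` vanishes only at the edge point with cell coordinates `(0, τ)`, `τ ∈ [0,1] ∩ K`, is a
presentable denominator: for `0 < τ < 1` the cell is split at height `τ` and both halves are
vertex germs; for `τ ∈ {0, 1}` the cell itself is. [this work] -/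
theorem soloInformed_presentableDenK_edgeCell
    (hK : ∀ c : K, IsAlgebraic ℚ (algebraMap K ℝ c)) (hKrc : SoloInformedRealRootClosed K)
    (e : Fin 2 →₀ ℕ) {u : K} (hu : u ≠ 0) {R : MvPolynomial (Fin 2) K} {N : ℕ} (hN : 0 < N)
    {c : Fin 2 → ℕ} (hc0 : c 0 = 0) (hc1 : 1 ≤ c 1) {τ : ℝ} (hτ0 : 0 ≤ τ) (hτ1 : τ ≤ 1)
    (hτK : ∃ τK : K, algebraMap K ℝ τK = τ)
    (hP0 : ∀ x ∈ soloInformedOpenCube 2, (MvPolynomial.aeval (fun j => ((c j : ℝ) + x j) / N)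
      (MvPolynomial.monomial e u * R) : ℝ) ≠ 0)
    (hRc : ∀ y ∈ soloInformedCube 2, y ≠ ![0, τ] →
      (MvPolynomial.aeval (fun j => ((c j : ℝ) + y j) / N) R : ℝ) ≠ 0) :
    SoloInformedPresentableDenK
      (soloInformedGridSubstK Finset.univ N c (MvPolynomial.monomial e u * R)) := by
  obtain ⟨τK, hτK⟩ := hτK
  have hNr : (0 : ℝ) < N := by exact_mod_cast hN
  have hNK : (N : K) ≠ 0 := soloInformed_natCast_ne_zeroK hN
  have h01 : (0 : Fin 2) ≠ 1 := by decide
  have hsm : ∀ (α β : ℝ) (x : Fin 2 → ℝ), soloInformedScaleMoveR 1 α β x 0 = x 0 :=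
    fun α β x => soloInformed_scaleMoveR_apply_ne 1 α β x h01
  set T := soloInformedGridSubstK Finset.univ N c (MvPolynomial.monomial e u * R) with hT
  set W := soloInformedGridSubstK Finset.univ N c
    (MvPolynomial.monomial (Finsupp.single 1 (e 1)) (1 : K)) with hW
  set Rc := soloInformedGridSubstK Finset.univ N c R with hRc'
  set u' : K := u * ((N : K)⁻¹) ^ e 0 with hu'
  have hu'0 : u' ≠ 0 := mul_ne_zero hu (pow_ne_zero _ (inv_ne_zero hNK))
  have hs10 : (Finsupp.single (1 : Fin 2) (e 1) : Fin 2 →₀ ℕ) 0 = 0 := by simp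
  have hs11 : (Finsupp.single (1 : Fin 2) (e 1) : Fin 2 →₀ ℕ) 1 = e 1 := by simp
  have hs00 : (Finsupp.single (0 : Fin 2) (e 0) : Fin 2 →₀ ℕ) 0 = e 0 := by simp
  have hs01 : (Finsupp.single (0 : Fin 2) (e 0) : Fin 2 →₀ ℕ) 1 = 0 := by simp
  have he' : ∀ j ∈ ({1} : Finset (Fin 2)), (Finsupp.single (0 : Fin 2) (e 0) : Fin 2 →₀ ℕ) j = 0 :=
    fun j hj => by rw [Finset.mem_singleton] at hj; rw [hj, hs01]
  -- values of `W`, `Rc`, `T`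
  have hWval : ∀ y : Fin 2 → ℝ, (MvPolynomial.aeval y W : ℝ) = (((c 1 : ℝ) + y 1) / N) ^ e 1 :=
    fun y => by
    rw [hW, soloInformed_aeval_gridSubstK, soloInformed_gridMoveR_univ, soloInformed_aevalK_monomial,
      map_one, one_mul, Fin.prod_univ_two, hs10, hs11, pow_zero, one_mul]
  have hWunit : ∀ y ∈ soloInformedCube 2, (MvPolynomial.aeval y W : ℝ) ≠ 0 := fun y hy => by
    rw [hWval]
    have h1 : (1 : ℝ) ≤ c 1 := by exact_mod_cast hc1
    have := (hy 1).1
    exact pow_ne_zero _ (div_pos (by linarith) hNr).ne'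
  have hRcval : ∀ y : Fin 2 → ℝ, (MvPolynomial.aeval y Rc : ℝ) =
      MvPolynomial.aeval (fun j => ((c j : ℝ) + y j) / N) R := fun y => by
    rw [hRc', soloInformed_aeval_gridSubstK, soloInformed_gridMoveR_univ]
  have hTval : ∀ x : Fin 2 → ℝ, (MvPolynomial.aeval x T : ℝ) = MvPolynomial.aeval x
      (MvPolynomial.monomial (Finsupp.single 0 (e 0)) u' * (W * Rc)) := fun x => by
    rw [hT, soloInformed_aeval_gridSubstK, soloInformed_gridMoveR_univ]
    simp only [map_mul, soloInformed_aevalK_monomial, hWval, hRcval, Fin.prod_univ_two, hs00, hs01,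
      hc0, hu', map_pow, map_inv₀, map_natCast, Nat.cast_zero, zero_add, pow_zero, mul_one]
    ring
  have hT0 : ∀ x ∈ soloInformedOpenCube 2, (MvPolynomial.aeval x T : ℝ) ≠ 0 := fun x hx => by
    rw [hT, soloInformed_aeval_gridSubstK, soloInformed_gridMoveR_univ]
    exact hP0 x hx
  rcases hτ0.eq_or_lt with hτz | hτpos
  · -- `τ = 0`: the zero is the vertex `0` of the cell
    refine soloInformed_presentableDenK_of_vertexGerm hK hKrc ∅ (e := Finsupp.single 0 (e 0))
      (fun j hj => absurd hj (Finset.notMem_empty j)) hu'0 hWunit (F := Rc) (fun y hy hy0 => ?_)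
      hT0 fun x _ => hTval x
    rw [hRcval]
    refine hRc y hy ?_
    rw [← hτz]
    rwa [soloInformed_vertexMove_empty_zero] at hy0
  rcases hτ1.lt_or_eq with hτlt | hτone
  swap
  · -- `τ = 1`: the zero is the vertex `(0,1)` of the cell
    refine soloInformed_presentableDenK_of_vertexGerm hK hKrc {1} (e := Finsupp.single 0 (e 0))
      he' hu'0 hWunit (F := Rc) (fun y hy hy0 => ?_) hT0 fun x _ => hTval x
    rw [hRcval]
    refine hRc y hy ?_
    rw [hτone]
    rwa [soloInformed_vertexMove_one_zero] at hy0
  -- `0 < τ < 1`: split the cell at height `τ`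
  have hτK0 : 0 < algebraMap K ℝ τK := by rw [hτK]; exact hτpos
  have hτK1 : algebraMap K ℝ τK < 1 := by rw [hτK]; exact hτlt
  have h1τ : algebraMap K ℝ (1 - τK) = 1 - τ := by rw [map_sub, map_one, hτK]
  refine soloInformed_presentableDenK_of_split hK 1 τK hτK0 hτK1 (fun x hx _ => hT0 x hx) ?_ ?_
  · -- lower piece `x₁ ↦ τ x₁`: zero at the vertex `(0,1)`
    refine soloInformed_presentableDenK_of_vertexGerm hK hKrc {1} (e := Finsupp.single 0 (e 0))
      he' hu'0 (W := soloInformedScaleSubstK 1 0 τK W) (F := soloInformedScaleSubstK 1 0 τK Rc)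
      (fun y hy => ?_) (fun y hy hy0 => ?_) (fun x hx => ?_) fun x _ => ?_
    · rw [soloInformed_aeval_scaleSubstK, map_zero, hτK]
      exact hWunit _ (soloInformed_scaleMoveR_mem_cube 1 le_rfl hτ0 (by linarith) hy)
    · rw [soloInformed_aeval_scaleSubstK, map_zero, hτK, hRcval]
      refine hRc _ (soloInformed_scaleMoveR_mem_cube 1 le_rfl hτ0 (by linarith) hy) fun h => hy0 ?_
      have h0 := congr_fun h 0
      have h1 := congr_fun h 1
      rw [soloInformed_scaleMoveR_apply_ne 1 _ _ _ h01] at h0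
      rw [soloInformed_scaleMoveR_apply_self] at h1
      simp only [Matrix.cons_val_zero, Matrix.cons_val_one] at h0 h1
      have hy1 : y 1 = 1 := by
        have h2 : τ * (y 1 - 1) = 0 := by linarith
        rcases mul_eq_zero.1 h2 with h3 | h3
        · exact absurd h3 hτpos.ne'
        · linarith
      rw [soloInformed_vertexMove_one_zero]
      funext j
      fin_cases j
      · simpa using h0
      · simpa using hy1
    · rw [soloInformed_aeval_scaleSubstK, map_zero, hτK]
      exact hT0 _ (soloInformed_scaleMoveR_mem_openCube 1 le_rfl hτpos (by linarith) hx)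
    · rw [soloInformed_aeval_scaleSubstK, hTval]
      simp only [map_mul, soloInformed_aevalK_monomial, soloInformed_aeval_scaleSubstK,
        Fin.prod_univ_two, hs00, hs01, pow_zero, mul_one, hsm]
  · -- upper piece `x₁ ↦ τ + (1 − τ) x₁`: zero at the vertex `0`
    refine soloInformed_presentableDenK_of_vertexGerm hK hKrc ∅ (e := Finsupp.single 0 (e 0))
      (fun j hj => absurd hj (Finset.notMem_empty j)) hu'0
      (W := soloInformedScaleSubstK 1 τK (1 - τK) W) (F := soloInformedScaleSubstK 1 τK (1 - τK) Rc)
      (fun y hy => ?_) (fun y hy hy0 => ?_) (fun x hx => ?_) fun x _ => ?_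
    · rw [soloInformed_aeval_scaleSubstK, hτK, h1τ]
      exact hWunit _ (soloInformed_scaleMoveR_mem_cube 1 hτ0 (by linarith) (by linarith) hy)
    · rw [soloInformed_aeval_scaleSubstK, hτK, h1τ, hRcval]
      refine hRc _ (soloInformed_scaleMoveR_mem_cube 1 hτ0 (by linarith) (by linarith) hy)
        fun h => hy0 ?_
      have h0 := congr_fun h 0
      have h1 := congr_fun h 1
      rw [soloInformed_scaleMoveR_apply_ne 1 _ _ _ h01] at h0
      rw [soloInformed_scaleMoveR_apply_self] at h1
      simp only [Matrix.cons_val_zero, Matrix.cons_val_one] at h0 h1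
      have hy1 : y 1 = 0 := by
        have h2 : (1 - τ) * y 1 = 0 := by linarith
        rcases mul_eq_zero.1 h2 with h3 | h3
        · exact absurd h3 (by linarith)
        · exact h3
      rw [soloInformed_vertexMove_empty_zero]
      funext j
      fin_cases j
      · simpa using h0
      · simpa using hy1
    · rw [soloInformed_aeval_scaleSubstK, hτK, h1τ]
      exact hT0 _ (soloInformed_scaleMoveR_mem_openCube 1 hτ0 (by linarith) (by linarith) hx)
    · rw [soloInformed_aeval_scaleSubstK, hTval]
      simp only [map_mul, soloInformed_aevalK_monomial, soloInformed_aeval_scaleSubstK,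
        Fin.prod_univ_two, hs00, hs01, pow_zero, mul_one, hsm]

/-- **EDGE package.**  Over a real-root-closed field `K` of real algebraic numbers:
`u xᵉ · R` (`u ≠ 0`, no zero on the open square) is locally presentable at an edge point
`(0, t)` with `t > 0` in `K`, as soon as `R` has no zero `y ≠ (0, t)` in the closed square within
distance `r` of `(0, t)`. [this work] -/
theorem soloInformed_locallyPresentableDenK_edge
    (hK : ∀ c : K, IsAlgebraic ℚ (algebraMap K ℝ c)) (hKrc : SoloInformedRealRootClosed K)
    (e : Fin 2 →₀ ℕ) {u : K} (hu : u ≠ 0) {R : MvPolynomial (Fin 2) K}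
    (hP0 : ∀ x ∈ soloInformedOpenCube 2,
      (MvPolynomial.aeval x (MvPolynomial.monomial e u * R) : ℝ) ≠ 0)
    {t : ℝ} (ht0 : 0 < t) (htK : ∃ tK : K, algebraMap K ℝ tK = t) {r : ℝ} (hr : 0 < r)
    (hiso : ∀ y ∈ soloInformedCube 2, dist y ![0, t] < r → y ≠ ![0, t] →
      (MvPolynomial.aeval y R : ℝ) ≠ 0) :
    SoloInformedLocallyPresentableDenK (MvPolynomial.monomial e u * R) ![0, t] := by
  refine ⟨min r (t / 2), lt_min hr (by linarith), fun N c hN hc hcell => ?_⟩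
  have hNr : (0 : ℝ) < N := by exact_mod_cast hN
  have hclose : ∀ y ∈ soloInformedCube 2, dist (fun j => ((c j : ℝ) + y j) / N) ![0, t] < r :=
    fun y hy => lt_of_lt_of_le (Metric.mem_ball.1 (hcell y hy)) (min_le_left _ _)
  by_cases hmem : ∃ z ∈ soloInformedCube 2, (fun j => ((c j : ℝ) + z j) / N) = ![0, t]
  · obtain ⟨z, hz, hzp⟩ := hmem
    have hz0 := congr_fun hzp 0
    have hz1 := congr_fun hzp 1
    simp only [Matrix.cons_val_zero, Matrix.cons_val_one] at hz0 hz1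
    rw [div_eq_zero_iff] at hz0
    have hsum := hz0.resolve_right hNr.ne'
    have hc0 : c 0 = 0 := by
      have h := (hz 0).1
      have h' : (c 0 : ℝ) = 0 := by linarith [(Nat.cast_nonneg (c 0) : (0 : ℝ) ≤ c 0)]
      exact_mod_cast h'
    have hz00 : z 0 = 0 := by rw [hc0, Nat.cast_zero, zero_add] at hsum; exact hsum
    -- the corner `c/N` is `t/2`-close to `(0, t)`, so `c 1 ≥ 1`
    have hc1 : 1 ≤ c 1 := by
      have hcorner := hcell 0 fun j => ⟨le_rfl, zero_le_one⟩
      have h1 := (dist_le_pi_dist _ (![0, t] : Fin 2 → ℝ) 1).trans_lt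
        (lt_of_lt_of_le (Metric.mem_ball.1 hcorner) (min_le_right _ _))
      simp only [Pi.zero_apply, add_zero, Matrix.cons_val_one, Matrix.cons_val_zero,
        Real.dist_eq] at h1
      by_contra hlt
      have hc10 : c 1 = 0 := by omega
      rw [hc10, Nat.cast_zero, zero_div, zero_sub, abs_neg, abs_of_pos ht0] at h1
      linarith
    have hτK : ∃ τK : K, algebraMap K ℝ τK = z 1 := by
      obtain ⟨tK, htK⟩ := htK
      refine ⟨(N : K) * tK - (c 1 : K), ?_⟩
      rw [map_sub, map_mul, map_natCast, map_natCast, htK, ← hz1]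
      field_simp
      ring
    refine soloInformed_presentableDenK_edgeCell hK hKrc e hu hN hc0 hc1 (hz 1).1 (hz 1).2 hτK
      (fun x hx => hP0 _ ?_) fun y hy hyz => hiso _ (soloInformed_cellPoint_mem_cube hc hy)
        (hclose y hy) fun hyp => hyz ?_
    · rw [← soloInformed_gridMoveR_univ N c x]
      exact soloInformed_gridMoveR_mem_openCube _ hc hx
    · have hinj : y = z := by
        funext j
        have h := congr_fun (hyp.trans hzp.symm) j
        have h' : (c j : ℝ) + y j = (c j : ℝ) + z j := by
          simpa [div_left_inj' hNr.ne'] using h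
        linarith
      rw [hinj]
      funext j
      fin_cases j
      · simpa using hz00
      · simp
  · -- the zero is not in the closed cell: CELL-LEAF
    push Not at hmem
    exact soloInformed_presentableDenK_gridSubst_monomial_mul hK e hu hN c fun y hy =>
      hiso _ (soloInformed_cellPoint_mem_cube hc hy) (hclose y hy) (hmem y hy)

end Summit.KontsevichZagierPeriods.KontsevichZagierPeriods.Theorems
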